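import Mathlib
import Summits.CriticalPhenomena.Ising3DConformalLimit.Theses.HarmonicMomentsIsotropy
import Summits.CriticalPhenomena.Ising3DConformalLimit.Theorems.HarmonicMomentsIsotropyHarmonicDilution
import Summits.CriticalPhenomena.Ising3DConformalLimit.Theorems.HarmonicMomentsIsotropyHarmonicDilutionSymmetric
import Summits.CriticalPhenomena.Ising3DConformalLimit.Theorems.HarmonicMomentsIsotropyHarmonicDilutionQuarticSymmetrization
import Summits.CriticalPhenomena.Ising3DConformalLimit.Theorems.HarmonicMomentsIsotropyHarmonicDilutionReynolds
import HarnessLib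

/-!
# Route HarmonicMomentsIsotropy — the quartic slice of `HarmonicDilution` is the `K₄` family

Item `stmt-CriticalPhenomena-6034` (`HarmonicDilution`, the subcritical harmonic-dilution
milestone of the route: every anisotropy ratio
`a_{Y,m}(β) = ∑_x Y(x)|x|^{2m}G_β(x) / ∑_x |x|^{n+2m}G_β(x)`, `G_β = ⟨σ₀σ_x⟩^∅_β` on `ℤ³`,
`Y` harmonic homogeneous of degree `n ≥ 1`, tends to `0` as `β ↑ β_c(3)`) is, as filed, the open
prediction of Campostrini–Pelissetto–Rossi–Vicari (`ρ_Y > 0` for every cubic harmonic).  The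
companion files prove it from the crux `AngularHierarchy` (`harmonicDilution_of_angularHierarchy`)
and reduce it unconditionally to the even degrees `n ≥ 4` (`harmonicDilution_iff_even_four_le`).

This file settles the STRUCTURE of the first open degree, `n = 4`, unconditionally: for every
harmonic homogeneous quartic `Y` and every `0 ≤ β < β_c(3)`,

  `∑_x Y(x)|x|^{2m}G_β(x) = (5/6)·c_A(Y) · ∑_x K₄(x)|x|^{2m}G_β(x)`
  (`harmonicMoment_degree_four`),

where `K₄(x) = ∑ᵢ xᵢ⁴ - (3/5)|x|⁴` is the cubic harmonic of degree four and
`c_A(Y) = Y_{(4,0,0)} + Y_{(0,4,0)} + Y_{(0,0,4)}` the sum of the three pure quartic coefficients.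
Consequently the degree-4 slice of `HarmonicDilution` is EQUIVALENT to the one-parameter family
`a_{K₄,m}(β) → 0` (`m ≥ 0`) (`harmonicDilution_degree_four_iff_K4`), `HarmonicDilution` implies it
(`harmonicDilution_K4`, the lattice form of CPRV's `q_{4,2m}/m_{4+2m} → 0`, i.e. `ρ₄ > 0` with no
rate), and the whole item is equivalent to that family together with its restriction to the even
degrees `n ≥ 6` (`harmonicDilution_iff_K4_and_six_le`), indeed to the `B₃`-invariant harmonics of
even degree `n ≥ 6` (`harmonicDilution_iff_K4_and_invariant_six_le`, with the Reynolds reduction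
of the companion file).  This is the precise Lean target for the
planner's foreseen first instance `AH4` and for the route's cheapest falsifier (HT series /
Monte Carlo for `q_{4,0}/m₄`).

## The argument

(Algebra in `HarmonicMomentsIsotropyHarmonicDilutionQuarticSymmetrization.lean`; the action of
`B₃` on polynomials and `summable_polyMoment` in
`HarmonicMomentsIsotropyHarmonicDilutionReynolds.lean`.)
Hyperoctahedral symmetrisation.  For `Y` homogeneous of degree `4`, the sign sum
`∑_ε Y(ε w)` keeps only the six even monomials (`sum_signs_eval_of_degree_four`, from the
fifteen sign sums `prod_signs_of_sum_four`); summing over the six coordinate permutations gives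
`∑_{g ∈ B₃} Y(g v) = 16 (c_A ∑ᵢvᵢ⁴) + 8 c_B ((∑ vᵢ²)² - ∑ vᵢ⁴)` with
`c_B = Y_{(2,2,0)} + Y_{(2,0,2)} + Y_{(0,2,2)}` (`sum_perm_pow_four`, `sum_perm_sq_sq`, by
reindexing — no enumeration of `S₃`).  The Laplacian, read off at the coefficients of `xᵢ²`
(`MvPolynomial.coeff_pderiv`), gives `3 c_A + c_B = 0` (`quartic_trace_of_harmonic`), whence
`∑_g Y(g v) = 40 c_A K₄(v)` (`symmetrization_of_degree_four`).  Since `K₄` is `B₃`-invariant,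
`Z = Y - (5/6)c_A K₄` has vanishing symmetrisation, so its moments vanish for every `β`
(`harmonicMoment_eq_zero_of_symmetrization`, lattice symmetry of `⟨σ₀σ_x⟩^∅_β`); below `β_c` all
moments are summable (`summable_polyMoment`, exponential decay) and linearity of `∑'` gives the
identity.  `K₄` itself is exhibited as the polynomial `∑ Xᵢ⁴ - C(3/5)(∑ Xᵢ²)²`, homogeneous and
harmonic (`K4poly_isHomogeneous`, `K4poly_harmonic`: `Δ∑xᵢ⁴ = 12|x|²`, `Δ|x|⁴ = 20|x|²`).

What is NOT here: any statement about the truth of the `K₄` family (open: CampostriniEtAl1998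
§4.6 predict `a_{K₄,0} ~ ξ^{-ρ}`, `ρ = 2 + η - η₄ ≈ 2.02`); the analogous one-dimensionality of the
invariant harmonics in degrees `6, 8, 10` (true, same method, not needed by the route yet).
-/

namespace Summit.CriticalPhenomena.Ising3DConformalLimit.Theorems

open Filter Topology Set
open Literature.Probability.LatticeModels
open Summit.CriticalPhenomena.Ising3DConformalLimit.Theses.HarmonicMomentsIsotropy

/-! ### Quartic harmonic moments are multiples of the `K₄` moment -/

/-- **Quartic harmonic moments are `K₄` moments.**  For a harmonic homogeneous quartic `Y` and
`0 ≤ β < β_c(3)`: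
`∑_x Y(x)|x|^{2m}G_β(x) = (5/6)·c_A(Y) · ∑_x K₄(x)|x|^{2m}G_β(x)`, where
`c_A(Y) = Y_{(4,0,0)} + Y_{(0,4,0)} + Y_{(0,0,4)}` and `K₄(x) = ∑ xᵢ⁴ - (3/5)|x|⁴`: the polynomial
`Y - (5/6)c_A K₄` has vanishing hyperoctahedral symmetrisation, so its moment vanishes by lattice
symmetry (`harmonicMoment_eq_zero_of_symmetrization`). -/
theorem harmonicMoment_degree_four {β : ℝ} (hβ : 0 ≤ β) (hβc : β < criticalBeta 3)
    (Y : MvPolynomial (Fin 3) ℝ) (hY : Y.IsHomogeneous 4)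
    (hΔ : ∑ i : Fin 3, MvPolynomial.pderiv i (MvPolynomial.pderiv i Y) = 0) (m : ℕ) :
    ∑' x : Site 3, MvPolynomial.eval (fun i => ((x i : ℤ) : ℝ)) Y *
        Real.sqrt (∑ j, ((x j : ℤ) : ℝ) ^ 2) ^ (2 * m) * twoPointFree 3 β x =
      5 / 6 * (Y.coeff (Finsupp.single 0 4) + Y.coeff (Finsupp.single 1 4) +
          Y.coeff (Finsupp.single 2 4)) *
        ∑' x : Site 3, ((∑ i : Fin 3, ((x i : ℤ) : ℝ) ^ 4) -
            3 / 5 * (∑ i : Fin 3, ((x i : ℤ) : ℝ) ^ 2) ^ 2) *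
          Real.sqrt (∑ j, ((x j : ℤ) : ℝ) ^ 2) ^ (2 * m) * twoPointFree 3 β x := by
  set cA : ℝ := Y.coeff (Finsupp.single 0 4) + Y.coeff (Finsupp.single 1 4) +
    Y.coeff (Finsupp.single 2 4) with hcA
  set P : MvPolynomial (Fin 3) ℝ := ∑ i : Fin 3, MvPolynomial.X i ^ 4 -
    MvPolynomial.C (3 / 5 : ℝ) * (∑ i : Fin 3, MvPolynomial.X i ^ 2) ^ 2 with hP
  set Z : MvPolynomial (Fin 3) ℝ := Y - MvPolynomial.C (5 / 6 * cA) * P with hZ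
  have hZeval : ∀ v : Fin 3 → ℝ, MvPolynomial.eval v Z =
      MvPolynomial.eval v Y -
        5 / 6 * cA * ((∑ i : Fin 3, v i ^ 4) - 3 / 5 * (∑ i : Fin 3, v i ^ 2) ^ 2) := by
    intro v
    rw [hZ, map_sub, map_mul, MvPolynomial.eval_C, hP, eval_K4poly]
  -- the symmetrisation of `Z` vanishes
  have hsymZ : ∀ v : Fin 3 → ℝ, ∑ g ∈ (Finset.univ : Finset (Equiv.Perm (Fin 3) × (Fin 3 → ℤˣ))),
      MvPolynomial.eval (fun i => ((g.2 i : ℤ) : ℝ) * v (g.1.symm i)) Z = 0 := by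
    intro v
    have h1 : ∀ g : Equiv.Perm (Fin 3) × (Fin 3 → ℤˣ),
        MvPolynomial.eval (fun i => ((g.2 i : ℤ) : ℝ) * v (g.1.symm i)) Z =
          MvPolynomial.eval (fun i => ((g.2 i : ℤ) : ℝ) * v (g.1.symm i)) Y -
            5 / 6 * cA * ((∑ i : Fin 3, v i ^ 4) - 3 / 5 * (∑ i : Fin 3, v i ^ 2) ^ 2) := by
      intro g
      rw [hZeval, K4_signedPerm]
    rw [Finset.sum_congr rfl fun g _ => h1 g, Finset.sum_sub_distrib,
      symmetrization_of_degree_four Y hY hΔ v, Finset.sum_const, card_signedPerm_three,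
      nsmul_eq_mul]
    rw [← hcA]
    push_cast
    ring
  have hkZ := harmonicMoment_eq_zero_of_symmetrization β Z Finset.univ_nonempty hsymZ m
  -- summability of the two moments
  have hsY := summable_polyMoment hβ hβc Y hY m
  have hsK : Summable fun x : Site 3 => ((∑ i : Fin 3, ((x i : ℤ) : ℝ) ^ 4) -
      3 / 5 * (∑ i : Fin 3, ((x i : ℤ) : ℝ) ^ 2) ^ 2) *
        Real.sqrt (∑ j, ((x j : ℤ) : ℝ) ^ 2) ^ (2 * m) * twoPointFree 3 β x := by
    refine (summable_polyMoment hβ hβc P K4poly_isHomogeneous m).congr (fun x => ?_)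
    rw [hP, eval_K4poly]
  have hpt : ∀ x : Site 3, MvPolynomial.eval (fun i => ((x i : ℤ) : ℝ)) Z *
      Real.sqrt (∑ j, ((x j : ℤ) : ℝ) ^ 2) ^ (2 * m) * twoPointFree 3 β x =
      MvPolynomial.eval (fun i => ((x i : ℤ) : ℝ)) Y *
          Real.sqrt (∑ j, ((x j : ℤ) : ℝ) ^ 2) ^ (2 * m) * twoPointFree 3 β x -
        5 / 6 * cA * (((∑ i : Fin 3, ((x i : ℤ) : ℝ) ^ 4) -
            3 / 5 * (∑ i : Fin 3, ((x i : ℤ) : ℝ) ^ 2) ^ 2) *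
          Real.sqrt (∑ j, ((x j : ℤ) : ℝ) ^ 2) ^ (2 * m) * twoPointFree 3 β x) := by
    intro x; rw [hZeval]; ring
  rw [tsum_congr hpt, hsY.tsum_sub (hsK.mul_left _), tsum_mul_left] at hkZ
  linarith

/-! ### The quartic slice of `HarmonicDilution` -/

/-- **The degree-4 slice of `HarmonicDilution` is the `K₄` family.**  The conclusion of
`HarmonicDilution` for all harmonic homogeneous quartics `Y` and all radial orders `m` is
equivalent to the single family of statements
`a_{K₄,m}(β) = ∑_x K₄(x)|x|^{2m}G_β(x) / ∑_x |x|^{4+2m}G_β(x) → 0` as `β ↑ β_c(3)`, `m ≥ 0`,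
`K₄(x) = ∑ xᵢ⁴ - (3/5)|x|⁴` (CPRV's `q_{4,2m}/m_{4+2m}`; the first open instance of the item). -/
theorem harmonicDilution_degree_four_iff_K4 :
    (∀ (m : ℕ) (Y : MvPolynomial (Fin 3) ℝ), Y.IsHomogeneous 4 →
        (∑ i : Fin 3, MvPolynomial.pderiv i (MvPolynomial.pderiv i Y)) = 0 →
        Tendsto (fun β => (∑' x : Site 3, MvPolynomial.eval (fun i => ((x i : ℤ) : ℝ)) Y *
              Real.sqrt (∑ i, ((x i : ℤ) : ℝ) ^ 2) ^ (2 * m) * twoPointFree 3 β x) /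
            (∑' x : Site 3, Real.sqrt (∑ i, ((x i : ℤ) : ℝ) ^ 2) ^ (4 + 2 * m) *
              twoPointFree 3 β x))
          (𝓝[<] criticalBeta 3) (𝓝 0)) ↔
    (∀ m : ℕ, Tendsto (fun β => (∑' x : Site 3, ((∑ i : Fin 3, ((x i : ℤ) : ℝ) ^ 4) -
              3 / 5 * (∑ i : Fin 3, ((x i : ℤ) : ℝ) ^ 2) ^ 2) *
              Real.sqrt (∑ i, ((x i : ℤ) : ℝ) ^ 2) ^ (2 * m) * twoPointFree 3 β x) /
            (∑' x : Site 3, Real.sqrt (∑ i, ((x i : ℤ) : ℝ) ^ 2) ^ (4 + 2 * m) *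
              twoPointFree 3 β x))
          (𝓝[<] criticalBeta 3) (𝓝 0)) := by
  constructor
  · intro h m
    have hm := h m _ K4poly_isHomogeneous K4poly_harmonic
    refine hm.congr (fun β => ?_)
    rw [tsum_congr (fun x => by rw [eval_K4poly])]
  · intro h m Y hY hΔ
    have hβc : 0 < criticalBeta 3 := criticalBeta_pos_holds (by norm_num)
    set cA : ℝ := Y.coeff (Finsupp.single 0 4) + Y.coeff (Finsupp.single 1 4) +
      Y.coeff (Finsupp.single 2 4) with hcA
    have hlim := (h m).const_mul (5 / 6 * cA)
    rw [mul_zero] at hlim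
    refine hlim.congr' ?_
    filter_upwards [Ioo_mem_nhdsLT hβc] with β hβ
    rw [harmonicMoment_degree_four hβ.1.le hβ.2 Y hY hΔ m, mul_div_assoc]

/-- **The first open instance of the milestone.**  `HarmonicDilution` (item
stmt-CriticalPhenomena-6034) implies — and in degree `4` is equivalent to — the vanishing of the
`K₄` anisotropy ratios: for every `m ≥ 0`,
`∑_x (∑ xᵢ⁴ - (3/5)|x|⁴)|x|^{2m}⟨σ₀σ_x⟩^∅_β / ∑_x |x|^{4+2m}⟨σ₀σ_x⟩^∅_β → 0` as `β ↑ β_c(3)`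
(the no-rate form of CPRV's `ρ > 0` for the spin-4 cubic operator). -/
theorem harmonicDilution_K4 (h : HarmonicDilution) (m : ℕ) :
    Tendsto (fun β => (∑' x : Site 3, ((∑ i : Fin 3, ((x i : ℤ) : ℝ) ^ 4) -
          3 / 5 * (∑ i : Fin 3, ((x i : ℤ) : ℝ) ^ 2) ^ 2) *
          Real.sqrt (∑ i, ((x i : ℤ) : ℝ) ^ 2) ^ (2 * m) * twoPointFree 3 β x) /
        (∑' x : Site 3, Real.sqrt (∑ i, ((x i : ℤ) : ℝ) ^ 2) ^ (4 + 2 * m) * twoPointFree 3 β x))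
      (𝓝[<] criticalBeta 3) (𝓝 0) := by
  dsimp only [HarmonicDilution] at h
  exact harmonicDilution_degree_four_iff_K4.1 (fun m Y hY hΔ => h 4 m Y (by norm_num) hY hΔ) m

/-- **Reduction of the item past its first instance.**  `HarmonicDilution` is equivalent to the
conjunction of (i) the `K₄` family `a_{K₄,m} → 0` (`m ≥ 0`) and (ii) its restriction to harmonic
homogeneous `Y` of even degree `n ≥ 6` (the higher cubic harmonics `K₆, K₈, …`); degrees
`n ≤ 3` and odd `n` are unconditional (`harmonicDilution_iff_even_four_le`). -/
theorem harmonicDilution_iff_K4_and_six_le :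
    HarmonicDilution ↔
      ((∀ m : ℕ, Tendsto (fun β => (∑' x : Site 3, ((∑ i : Fin 3, ((x i : ℤ) : ℝ) ^ 4) -
              3 / 5 * (∑ i : Fin 3, ((x i : ℤ) : ℝ) ^ 2) ^ 2) *
              Real.sqrt (∑ i, ((x i : ℤ) : ℝ) ^ 2) ^ (2 * m) * twoPointFree 3 β x) /
            (∑' x : Site 3, Real.sqrt (∑ i, ((x i : ℤ) : ℝ) ^ 2) ^ (4 + 2 * m) *
              twoPointFree 3 β x))
          (𝓝[<] criticalBeta 3) (𝓝 0)) ∧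
      ∀ (n m : ℕ) (Y : MvPolynomial (Fin 3) ℝ), 6 ≤ n → Even n → Y.IsHomogeneous n →
        (∑ i : Fin 3, MvPolynomial.pderiv i (MvPolynomial.pderiv i Y)) = 0 →
        Tendsto (fun β => (∑' x : Site 3, MvPolynomial.eval (fun i => ((x i : ℤ) : ℝ)) Y *
              Real.sqrt (∑ i, ((x i : ℤ) : ℝ) ^ 2) ^ (2 * m) * twoPointFree 3 β x) /
            (∑' x : Site 3, Real.sqrt (∑ i, ((x i : ℤ) : ℝ) ^ 2) ^ (n + 2 * m) *
              twoPointFree 3 β x))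
          (𝓝[<] criticalBeta 3) (𝓝 0)) := by
  rw [harmonicDilution_iff_even_four_le]
  constructor
  · intro h
    refine ⟨harmonicDilution_degree_four_iff_K4.1
        (fun m Y hY hΔ => h 4 m Y le_rfl (by decide) hY hΔ),
      fun n m Y hn he hY hΔ => h n m Y (by omega) he hY hΔ⟩
  · rintro ⟨hK4, h6⟩ n m Y hn he hY hΔ
    rcases Nat.lt_or_ge n 6 with hlt | hge
    · -- `n = 4` (`n = 5` is odd)
      have hn4 : n = 4 := by
        rcases he with ⟨k, rfl⟩
        omega
      subst hn4
      exact harmonicDilution_degree_four_iff_K4.2 hK4 m Y hY hΔ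
    · exact h6 n m Y hge he hY hΔ

/-- **The item, fully reduced.**  `HarmonicDilution` is equivalent to the conjunction of
(i) the `K₄` family `a_{K₄,m}(β) → 0` (`m ≥ 0`) and (ii) its restriction to the `B₃`-INVARIANT
harmonic homogeneous `Y` of even degree `n ≥ 6` (the higher cubic harmonics `K₆, K₈, K₁₀`, the
two-dimensional invariant sector in degree `12`, …) — combining the quartic slice with the
Reynolds reduction `harmonicDilution_iff_invariant`. -/
theorem harmonicDilution_iff_K4_and_invariant_six_le :
    HarmonicDilution ↔
      ((∀ m : ℕ, Tendsto (fun β => (∑' x : Site 3, ((∑ i : Fin 3, ((x i : ℤ) : ℝ) ^ 4) -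
              3 / 5 * (∑ i : Fin 3, ((x i : ℤ) : ℝ) ^ 2) ^ 2) *
              Real.sqrt (∑ i, ((x i : ℤ) : ℝ) ^ 2) ^ (2 * m) * twoPointFree 3 β x) /
            (∑' x : Site 3, Real.sqrt (∑ i, ((x i : ℤ) : ℝ) ^ 2) ^ (4 + 2 * m) *
              twoPointFree 3 β x))
          (𝓝[<] criticalBeta 3) (𝓝 0)) ∧
      ∀ (n m : ℕ) (Y : MvPolynomial (Fin 3) ℝ), 6 ≤ n → Even n → Y.IsHomogeneous n →
        (∑ i : Fin 3, MvPolynomial.pderiv i (MvPolynomial.pderiv i Y)) = 0 →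
        (∀ (π : Equiv.Perm (Fin 3)) (ε : Fin 3 → ℤˣ) (v : Fin 3 → ℝ),
          MvPolynomial.eval (fun i => ((ε i : ℤ) : ℝ) * v (π.symm i)) Y = MvPolynomial.eval v Y) →
        Tendsto (fun β => (∑' x : Site 3, MvPolynomial.eval (fun i => ((x i : ℤ) : ℝ)) Y *
              Real.sqrt (∑ i, ((x i : ℤ) : ℝ) ^ 2) ^ (2 * m) * twoPointFree 3 β x) /
            (∑' x : Site 3, Real.sqrt (∑ i, ((x i : ℤ) : ℝ) ^ 2) ^ (n + 2 * m) *
              twoPointFree 3 β x))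
          (𝓝[<] criticalBeta 3) (𝓝 0)) := by
  constructor
  · intro h
    refine ⟨harmonicDilution_K4 h, fun n m Y hn he hY hΔ _ => ?_⟩
    exact (harmonicDilution_iff_even_four_le.1 h) n m Y (by omega) he hY hΔ
  · rintro ⟨hK4, h6⟩
    rw [harmonicDilution_iff_invariant]
    intro n m Y hn he hY hΔ hinv
    rcases Nat.lt_or_ge n 6 with hlt | hge
    · have hn4 : n = 4 := by
        rcases he with ⟨k, rfl⟩
        omega
      subst hn4
      exact harmonicDilution_degree_four_iff_K4.2 hK4 m Y hY hΔ
    · exact h6 n m Y hge he hY hΔ hinv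

end Summit.CriticalPhenomena.Ising3DConformalLimit.Theorems
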